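import Summits.RiemannHypothesis.RiemannHypothesis.Theorems.TiltedLandingLaw421R3RateChildCountB
import Summits.RiemannHypothesis.RiemannHypothesis.Theorems.TiltedLandingLaw421R3RateChildCountD

/-! # RATE CHILD COUNT (E) — EXISTENCE of the moving upper child at an `m`-FOLD pair (leaf L1 of R1a′; lens-2 g4, stmt-RiemannHypothesis-33346)

★★★ `exists_upper_child_m`: `G = q·h`, `H = 2m(z − a)·h + q·h′` (`(q^m·h)′ = q^(m−1)·H`), `h` real entire zero-free on the closed Jensen disc with
the Jensen sign on the circle, no NL event on the closed diameter (`H(x) = 0 ⇒ G(x)·H′(x) < 0`), `H ≠ 0` at the feet ⇒ an upper non-real zero `w` of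
`H` with `G(w) ≠ 0` in the closed disc.  PROOF = module (B)'s `exists_upper_child` with `G′ ↦ H` (count from module (D)'s `childCountM`; the real
function `φ = Re H / Re G` has only DOWNWARD zeros on the diameter; §3 of module (B)).  Imports (B), (D); namespace `RhW08.ChildCount`; 0 `sorry`.
Nothing here bears on the truth of RH; RH is not proved; 33346/33347 OPEN; checked ≠ proved. -/

noncomputable section

open Complex Metric Set
open scoped Real ComplexConjugate
open Literature.Topology.PlaneTopology
open Literature.Analysis.Complex

namespace RhW08.ChildCount

open RhW08.IsolatedTilt (pairQ)

set_option maxHeartbeats 1600000 in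
/-- ★★★ (K) **THE NESTED MOVING CHILD EXISTS, `m`-FOLD PAIR** (generic feet).  `G = q·h`, `H = 2m(z − a)h + q·h′` (`q = pairQ a b`,
`0 < b`, `m ≥ 1`; so `(q^m·h)′ = q^(m−1)·H`), `h` real entire and zero-free on the closed Jensen disc `‖z − a‖ ≤ b` with the Jensen sign on its
boundary circle; NO NL EVENT on the closed diameter in the form `H(x) = 0 ⇒ G(x)·H′(x) < 0` (`|x − a| ≤ b`; for `𝒢 = q^m·h` this is
`𝒢·𝒢″ < 0` at the real critical points, as `𝒢·𝒢″ = q^(2m−2)·G·H′` there); `H ≠ 0` at the two feet `a ± b`.  Then `H` has an UPPER NON-REAL zero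
`w` with `G(w) ≠ 0` (so `w ∉ {a ± ib}` and `h(w) ≠ 0`) in the closed Jensen disc `‖w − a‖ ≤ b`.  (Module (B)'s `exists_upper_child` is `m = 1`,
`H = G′`; this is its verbatim transform.) -/
theorem exists_upper_child_m {G H h : ℂ → ℂ} {a b ρ : ℝ} {m : ℕ} (hm1 : 0 < m) (hb : 0 < b) (hbρ : b < ρ)
    (hGd : Differentiable ℂ G) (hh : Differentiable ℂ h) (hfac : ∀ z, G z = pairQ a b z * h z)
    (hH : ∀ z, H z = 2 * (m : ℂ) * (z - a) * h z + pairQ a b z * deriv h z)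
    (hGreal : ∀ x : ℝ, (G x).im = 0) (hhreal : ∀ x : ℝ, (h x).im = 0)
    (hh0 : ∀ z ∈ closedBall (a : ℂ) b, h z ≠ 0)
    (hsign : ∀ z : ℂ, ‖z - a‖ = b → z.im * (deriv h z / h z).im ≤ 0)
    (hnoNL : ∀ x : ℝ, |x - a| ≤ b → (H x).re = 0 → (G x).re * (deriv H x).re < 0)
    (hfeet : H ((a : ℂ) + b) ≠ 0 ∧ H ((a : ℂ) - b) ≠ 0) :
    ∃ w : ℂ, H w = 0 ∧ G w ≠ 0 ∧ 0 < w.im ∧ ‖w - a‖ ≤ b := by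
  classical
  have hm0 : (m : ℂ) ≠ 0 := Nat.cast_ne_zero.2 hm1.ne'
  have hmR : (0 : ℝ) < m := Nat.cast_pos.2 hm1
  -- realness and symmetry
  have hh'd : Differentiable ℂ (deriv h) := by
    have := differentiable_iteratedDeriv_of_entire hh 1; rwa [iteratedDeriv_one] at this
  have hG'd : Differentiable ℂ (H) := by
    have hq : Differentiable ℂ (pairQ a b) := by unfold pairQ; fun_prop
    have e : H = fun z => 2 * (m : ℂ) * (z - a) * h z + pairQ a b z * deriv h z := funext hH
    rw [e]
    exact (((differentiable_const _).mul (differentiable_id.sub (differentiable_const _))).mul hh).add (hq.mul hh'd)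
  have hh'real : ∀ x : ℝ, (deriv h x).im = 0 := fun x => by
    have := im_iteratedDeriv_ofReal hh hhreal 1 x; rwa [iteratedDeriv_one] at this
  have hqx : ∀ x : ℝ, pairQ a b (x : ℂ) = ((((x - a) ^ 2 + b ^ 2 : ℝ)) : ℂ) := by
    intro x; simp only [pairQ]; push_cast; ring
  have hG'real : ∀ x : ℝ, (H x).im = 0 := fun x => by
    have eh : h x = (((h x).re : ℝ) : ℂ) := Complex.ext (by rw [ofReal_re]) (by rw [ofReal_im]; exact hhreal x)
    have eh' : deriv h x = (((deriv h x).re : ℝ) : ℂ) :=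
      Complex.ext (by rw [ofReal_re]) (by rw [ofReal_im]; exact hh'real x)
    rw [hH, hqx]; nth_rw 1 [eh]; nth_rw 1 [eh']
    have : (2 * (m : ℂ) * ((x : ℂ) - a) * (((h x).re : ℝ) : ℂ) + ((((x - a) ^ 2 + b ^ 2 : ℝ)) : ℂ) * (((deriv h x).re : ℝ) : ℂ))
        = (((2 * m * (x - a) * (h x).re + ((x - a) ^ 2 + b ^ 2) * (deriv h x).re : ℝ)) : ℂ) := by push_cast; ring
    rw [this, ofReal_im]
  have hderiv : ∀ z, H z = 2 * (m : ℂ) * (z - a) * h z + pairQ a b z * deriv h z := hH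
  have hq0 : ∀ u : ℂ, pairQ a b u = 0 → ‖u - a‖ = b := by
    intro u hu
    rw [RhW08.IsolatedTilt.pairQ_eq_mul] at hu
    rcases mul_eq_zero.1 hu with h | h
    · rw [sub_eq_zero] at h; rw [h]; simp [abs_of_pos hb]
    · rw [sub_eq_zero] at h; rw [h]; simp [abs_of_pos hb]
  have hGne : ∀ u : ℂ, ‖u - a‖ ≤ b → H u = 0 → G u ≠ 0 := by
    intro u hu hu0 hG0
    have hhu : h u ≠ 0 := hh0 u (by rw [mem_closedBall, dist_eq_norm]; exact hu)
    rw [hfac u] at hG0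
    rcases mul_eq_zero.1 hG0 with hq | hh'
    · have e := hderiv u
      rw [hu0, hq, zero_mul, add_zero] at e
      have hua : u - a ≠ 0 := by
        intro h0; have := hq0 u hq; rw [h0, norm_zero] at this; exact hb.ne' this.symm
      exact hhu ((mul_eq_zero.1 e.symm).resolve_left (mul_ne_zero (mul_ne_zero two_ne_zero hm0) hua))
    · exact hhu hh'
  have hconj : ∀ z, H (conj z) = conj (H z) := apply_conj_eq_conj hG'd hG'real
  have hnorm_conj : ∀ z : ℂ, ‖conj z - a‖ = ‖z - a‖ := by
    intro z; rw [← Complex.norm_conj (z - a), map_sub, Complex.conj_ofReal]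
  -- a non-real critical point ON the circle settles it
  by_cases hex : ∃ w : ℂ, ‖w - a‖ = b ∧ w.im ≠ 0 ∧ H w = 0
  · obtain ⟨w, hw, hwim, hw0⟩ := hex
    rcases lt_or_gt_of_ne hwim with hneg | hpos
    · have hc0 : H (conj w) = 0 := by rw [hconj, hw0, map_zero]
      exact ⟨conj w, hc0, hGne _ (by rw [hnorm_conj]; exact hw.le) hc0, by rw [conj_im]; linarith,
        by rw [hnorm_conj]; exact hw.le⟩
    · exact ⟨w, hw0, hGne w hw.le hw0, hpos, hw.le⟩
  push Not at hex
  have hcirc : ∀ z : ℂ, ‖z - a‖ = b → H z ≠ 0 := by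
    intro z hz
    by_cases hzim : z.im = 0
    · rcases eq_feet_of_real_on_circle hz hzim with h | h
      · rw [h]; exact hfeet.1
      · rw [h]; exact hfeet.2
    · exact hex z hz hzim
  have hKreal : ∀ x : ℝ, ‖(x : ℂ) - a‖ = b → (deriv h x / h x).im = 0 := by
    intro x _
    have e1 : deriv h x = (((deriv h x).re : ℝ) : ℂ) := Complex.ext (by rw [ofReal_re]) (by rw [ofReal_im]; exact hh'real x)
    have e2 : h x = (((h x).re : ℝ) : ℂ) := Complex.ext (by rw [ofReal_re]) (by rw [ofReal_im]; exact hhreal x)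
    rw [e1, e2, ← ofReal_div, ofReal_im]
  have hcount := childCountM hm1 hb hbρ hh.differentiableOn (fun z _ => hH z) hh0 hsign hKreal hcirc
  -- suppose there is no nested upper child
  by_contra hne
  push Not at hne
  -- then every critical point in the closed disc is real …
  have hzr : ∀ u ∈ closedBall (a : ℂ) b, H u = 0 → u.im = 0 := by
    intro u hu hu0
    rw [mem_closedBall, dist_eq_norm] at hu
    by_contra him
    rcases lt_or_gt_of_ne him with hneg | hpos
    · have hc0 : H (conj u) = 0 := by rw [hconj, hu0, map_zero]
      have h1 := hne (conj u) hc0 (hGne _ (by rw [hnorm_conj]; exact hu) hc0) (by rw [conj_im]; linarith)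
      rw [hnorm_conj] at h1; linarith
    · have h1 := hne u hu0 (hGne u hu hu0) hpos; linarith
  -- … and simple
  have hzs : ∀ u ∈ closedBall (a : ℂ) b, H u = 0 → deriv H u ≠ 0 := by
    intro u hu hu0
    have him := hzr u hu hu0
    rw [mem_closedBall, dist_eq_norm] at hu
    have hux : u = ((u.re : ℝ) : ℂ) := Complex.ext (by rw [ofReal_re]) (by rw [ofReal_im]; exact him)
    have habs : |u.re - a| ≤ b := by
      have := Complex.abs_re_le_norm (u - a); simp only [sub_re, ofReal_re] at this; exact this.trans hu
    have h0 : (H (u.re : ℝ)).re = 0 := by rw [← hux, hu0]; simp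
    have := hnoNL u.re habs h0
    intro hd
    rw [hux] at hd
    rw [hd] at this
    simp at this
  have hm := Rouche.finsum_divisor_eq_ncard_zeros (H) hb hbρ hG'd.differentiableOn hcirc hzs
  -- the real zero set of `G′` on the open diameter
  set Z : Set ℝ := {x | x ∈ Ioo (a - b) (a + b) ∧ (H x).re = 0} with hZ
  have hZim : {u : ℂ | ‖u - (a : ℂ)‖ < b ∧ H u = 0} = (fun x : ℝ => (x : ℂ)) '' Z := by
    ext u
    constructor
    · rintro ⟨hu, hu0⟩
      have him := hzr u (by rw [mem_closedBall, dist_eq_norm]; exact hu.le) hu0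
      have hux : u = ((u.re : ℝ) : ℂ) := Complex.ext (by rw [ofReal_re]) (by rw [ofReal_im]; exact him)
      refine ⟨u.re, ⟨?_, ?_⟩, hux.symm⟩
      · have h1 : |u.re - a| ≤ ‖u - (a : ℂ)‖ := by
          have := Complex.abs_re_le_norm (u - a); simpa only [sub_re, ofReal_re] using this
        have h2 := abs_lt.1 (lt_of_le_of_lt h1 hu)
        exact ⟨by linarith [h2.1], by linarith [h2.2]⟩
      · rw [← hux, hu0]; simp
    · rintro ⟨x, ⟨hx, hx0⟩, rfl⟩
      refine ⟨?_, Complex.ext (by rw [zero_re]; exact hx0) (by rw [zero_im]; exact hG'real x)⟩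
      rw [← ofReal_sub, Complex.norm_real, Real.norm_eq_abs, abs_lt]
      exact ⟨by linarith [hx.1], by linarith [hx.2]⟩
  have hfin : Z.Finite := by
    have hf := Rouche.finite_zeros (H) hb hbρ hG'd.differentiableOn hcirc
    refine Set.Finite.of_finite_image ?_ Complex.ofReal_injective.injOn
    rw [← hZim]
    exact hf.subset fun u ⟨hu, hu0⟩ => ⟨by rw [mem_closedBall, dist_eq_norm]; exact hu.le, hu0⟩
  have hncard : ({u : ℂ | ‖u - (a : ℂ)‖ < b ∧ H u = 0}.ncard : ℤ) = (hfin.toFinset.card : ℤ) := by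
    rw [hZim, Set.ncard_image_of_injective _ Complex.ofReal_injective, Set.ncard_eq_toFinset_card _ hfin]
  -- the real function `φ = Re H / Re G` on the closed diameter: continuous, zeros = real critical points, all DOWNWARD
  set φ : ℝ → ℝ := fun x => (H x).re / (G x).re with hφ
  have hball : ∀ x : ℝ, |x - a| ≤ b → (x : ℂ) ∈ closedBall (a : ℂ) b := fun x hx => by
    rw [mem_closedBall, dist_eq_norm, ← ofReal_sub, Complex.norm_real, Real.norm_eq_abs]; exact hx
  have hGx : ∀ x : ℝ, |x - a| ≤ b → (G x).re ≠ 0 := by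
    intro x hx h0
    have hGx0 : G x = 0 := Complex.ext (by rw [zero_re]; exact h0) (by rw [zero_im]; exact hGreal x)
    rw [hfac] at hGx0
    rcases mul_eq_zero.1 hGx0 with hq | hh'
    · have eq : pairQ a b (x : ℂ) = ((((x - a) ^ 2 + b ^ 2 : ℝ)) : ℂ) := by simp only [pairQ]; push_cast; ring
      have hQ : 0 < (x - a) ^ 2 + b ^ 2 := by positivity
      rw [eq] at hq
      exact hQ.ne' (by exact_mod_cast hq)
    · exact hh0 _ (hball x hx) hh'
  have hφc : ContinuousOn φ (Icc (a - b) (a + b)) := by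
    have c1 : Continuous fun x : ℝ => (H x).re :=
      Complex.continuous_re.comp (hG'd.continuous.comp Complex.continuous_ofReal)
    have c2 : Continuous fun x : ℝ => (G x).re :=
      Complex.continuous_re.comp (hGd.continuous.comp Complex.continuous_ofReal)
    exact c1.continuousOn.div c2.continuousOn fun x hx => hGx x (abs_le.2 ⟨by linarith [hx.1], by linarith [hx.2]⟩)
  have hφzero : ∀ x : ℝ, |x - a| ≤ b → (φ x = 0 ↔ (H x).re = 0) := by
    intro x hx
    simp only [hφ, div_eq_zero_iff]
    exact ⟨fun h => h.resolve_right (hGx x hx), Or.inl⟩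
  have hdown : ∀ x : ℝ, |x - a| ≤ b → φ x = 0 → ∃ d < 0, HasDerivAt φ d x := by
    intro x hx h0
    have h0' := (hφzero x hx).1 h0
    have h1 : HasDerivAt (fun y : ℝ => (H y).re) (deriv H x).re x :=
      (hG'd x).hasDerivAt.real_of_complex
    have h2 : HasDerivAt (fun y : ℝ => (G y).re) (deriv G x).re x := (hGd x).hasDerivAt.real_of_complex
    refine ⟨_, ?_, h1.div h2 (hGx x hx)⟩
    rw [h0', zero_mul, sub_zero]
    have := hnoNL x hx h0'
    have hsq : 0 < (G x).re ^ 2 := lt_of_le_of_ne (sq_nonneg _) (Ne.symm (pow_ne_zero 2 (hGx x hx)))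
    have hc : (deriv H ↑x).re * (G ↑x).re < 0 := by rw [mul_comm]; exact this
    exact div_neg_of_neg_of_pos hc hsq
  -- the finite set `T` of real critical points and the three real-axis lemmas of §3
  set T := hfin.toFinset with hT
  have hTmem : ∀ x, x ∈ T ↔ x ∈ Ioo (a - b) (a + b) ∧ (H x).re = 0 := fun x => by
    rw [hT, Set.Finite.mem_toFinset]; rfl
  have hreal_zero : ∀ x : ℝ, (H x).re = 0 → H x = 0 := fun x h0 =>
    Complex.ext (by rw [zero_re]; exact h0) (by rw [zero_im]; exact hG'real x)
  have hT1 : ∀ x ∈ Icc (a - b) (a + b), φ x = 0 → x ∈ T := by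
    intro x hx h0
    have hxa : |x - a| ≤ b := abs_le.2 ⟨by linarith [hx.1], by linarith [hx.2]⟩
    have h0' := (hφzero x hxa).1 h0
    rw [hTmem]
    refine ⟨⟨lt_of_le_of_ne hx.1 ?_, lt_of_le_of_ne hx.2 ?_⟩, h0'⟩
    · intro h
      apply hfeet.2
      have e : ((x : ℝ) : ℂ) = (a : ℂ) - b := by rw [← h]; push_cast; ring
      rw [← e]; exact hreal_zero x h0'
    · intro h
      apply hfeet.1
      have e : ((x : ℝ) : ℂ) = (a : ℂ) + b := by rw [h]; push_cast; ring
      rw [← e]; exact hreal_zero x h0'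
  have hT2 : ∀ x ∈ T, x ∈ Ioo (a - b) (a + b) ∧ φ x = 0 := by
    intro x hx
    rw [hTmem] at hx
    exact ⟨hx.1, (hφzero x (abs_le.2 ⟨by linarith [hx.1.1], by linarith [hx.1.2]⟩)).2 hx.2⟩
  have hT3 : ∀ x ∈ T, ∃ d < 0, HasDerivAt φ d x := fun x hx =>
    hdown x (abs_le.2 ⟨by linarith [(hT2 x hx).1.1], by linarith [(hT2 x hx).1.2]⟩) (hT2 x hx).2
  -- the value of `φ` on the diameter and at the two feet
  have hφval : ∀ x : ℝ, |x - a| ≤ b → φ x = 2 * m * (x - a) / ((x - a) ^ 2 + b ^ 2) + (deriv h x / h x).re := by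
    intro x hx
    have hu0 : (h x).re ≠ 0 := by
      intro h0
      exact hh0 _ (hball x hx) (Complex.ext (by rw [zero_re]; exact h0) (by rw [zero_im]; exact hhreal x))
    have eh : h x = (((h x).re : ℝ) : ℂ) := Complex.ext (by rw [ofReal_re]) (by rw [ofReal_im]; exact hhreal x)
    have eh' : deriv h x = (((deriv h x).re : ℝ) : ℂ) :=
      Complex.ext (by rw [ofReal_re]) (by rw [ofReal_im]; exact hh'real x)
    have eq : pairQ a b (x : ℂ) = ((((x - a) ^ 2 + b ^ 2 : ℝ)) : ℂ) := by simp only [pairQ]; push_cast; ring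
    have hQ : 0 < (x - a) ^ 2 + b ^ 2 := by positivity
    have eG : G x = ((((x - a) ^ 2 + b ^ 2) * (h x).re : ℝ) : ℂ) := by
      rw [hfac, eq]; nth_rw 1 [eh]; push_cast; ring
    have eG' : H x = (((2 * m * (x - a) * (h x).re + ((x - a) ^ 2 + b ^ 2) * (deriv h x).re : ℝ)) : ℂ) := by
      rw [hderiv, eq]; nth_rw 1 [eh]; nth_rw 1 [eh']; push_cast; ring
    have eK : (deriv h x / h x).re = (deriv h x).re / (h x).re := by
      nth_rw 1 [eh', eh]; rw [← ofReal_div, ofReal_re]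
    simp only [hφ]
    rw [eG', eG, ofReal_re, ofReal_re, eK]
    field_simp
  have hKre : ∀ z : ℂ, (deriv h z / ((m : ℂ) * h z)).re = (1 / (m : ℝ)) * (deriv h z / h z).re := by
    intro z
    have e : deriv h z / ((m : ℂ) * h z) = (((1 / (m : ℝ) : ℝ)) : ℂ) * (deriv h z / h z) := by push_cast; ring
    rw [e, re_ofReal_mul]
  have hbm : 0 < b / (m : ℝ) := div_pos hb hmR
  have hfoot1 : 1 + b * (deriv h ((a : ℂ) + b) / ((m : ℂ) * h ((a : ℂ) + b))).re = (b / m) * φ (a + b) := by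
    have := hφval (a + b) (by rw [add_sub_cancel_left, abs_of_pos hb])
    push_cast at this
    rw [hKre, this]
    field_simp
    ring
  have hfoot2 : 1 - b * (deriv h ((a : ℂ) - b) / ((m : ℂ) * h ((a : ℂ) - b))).re = -((b / m) * φ (a - b)) := by
    have := hφval (a - b) (by rw [sub_sub_cancel_left, abs_neg, abs_of_pos hb])
    push_cast at this
    rw [hKre, this]
    field_simp
    ring
  have c1 : ((b / m) * φ (a + b) < 0) ↔ (φ (a + b) < 0) :=
    ⟨fun h => by by_contra h'; push Not at h'; nlinarith [mul_nonneg hbm.le h'], fun h => mul_neg_of_pos_of_neg hbm h⟩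
  have c2 : (-((b / m) * φ (a - b)) < 0) ↔ (0 < φ (a - b)) := by
    rw [neg_lt_zero]; exact mul_pos_iff_of_pos_left hbm
  -- the count in terms of `T.card`
  have hcard : (T.card : ℤ) = 1 + (if φ (a + b) < 0 then 1 else 0) + (if 0 < φ (a - b) then 1 else 0) := by
    have e := hm.symm.trans hcount
    rw [hncard, hfoot1, hfoot2] at e
    simp only [c1, c2] at e
    exact e
  rcases T.eq_empty_or_nonempty with hTe | hTne
  · simp only [hTe, Finset.card_empty, Nat.cast_zero] at hcard
    split_ifs at hcard <;> omega
  · have h1 := pos_left_of_downward hφc T hT1 hT2 hT3 hTne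
    have h2 := neg_right_of_downward hφc T hT1 hT2 hT3 hTne
    have h3 := card_le_one_of_downward hφc T hT1 hT2 hT3
    rw [if_pos h2, if_pos h1] at hcard
    omega



end RhW08.ChildCount
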